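import Mathlib
import HarnessLib

/-!
# Route `IntegerScrew` — the `N`-rough part of an integer (keys of the top-down martingale, CONTINUUM-LIMIT §24)

`roughPart N x := Π_{p ≥ N} p^{v_p(x)}` — the part of `x` made of the primes `≥ N`.  Revealing the prime
coordinates of `x ≤ M` from the largest prime down (CONTINUUM-LIMIT §24.3) is the chain of partitions of `{1,…,M}`
by the keys `roughPart N`, `N = M+1, M, …, 2`: `roughPart (M+1) x = 1` (one atom), `roughPart 2 x = x` (points),
`roughPart N = roughPart (N+1)` unless `N` is prime, and for a prime `p`,
`roughPart p x = p^{v_p(x)} · roughPart (p+1) x` — the `roughPart p`-fibres refine the `roughPart (p+1)`-atoms by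
the `p`-adic valuation.  This file is the arithmetic of these keys (all via `Nat.factorization`):

* `roughPart`, `factorization_roughPart`, `roughPart_ne_zero`;
* `roughPart_succ_of_not_prime`, `roughPart_prime_eq`, `roughPart_two`, `roughPart_eq_one_of_le`;
* `roughPart_roughPart`, `roughPart_succ_div_pow`, `roughPart_succ_mul_pow`, `not_dvd_roughPart_succ`;
* `roughPart_prime_eq_iff` — `roughPart p x = roughPart p y ↔ roughPart (p+1) x = roughPart (p+1) y ∧ v_p x = v_p y`.

RH-free bookkeeping for `IntegerScrewMartingale`.

References: CONTINUUM-LIMIT §24 (rh-explicit A6-PIVOT); M. Suzuki, J. Lond. Math. Soc. (2) 108 (2023) 1448–1487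
[Suzuki2023].
-/

noncomputable section

set_option linter.dupNamespace false -- D-0017: `Summit.<S>.<S>.…` is the designed namespace

namespace Summit.RiemannHypothesis.RiemannHypothesis.Theorems.IntegerScrew

open Finset

/-- The `N`-ROUGH PART of `x`: `Π_{p ≥ N, p ∣ x} p^{v_p(x)}` (as a `Finsupp.prod` over the factorization filtered to
the primes `≥ N`; for `x ≠ 0` it equals `x / Literature.NumberTheory.Sieve.smoothPart N x` — kept here in
factorization form, Mathlib-only, because every property below is read off `Nat.factorization`). -/
def roughPart (N x : ℕ) : ℕ := (x.factorization.filter (fun p => N ≤ p)).prod (· ^ ·)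

/-- The factorization of the rough part is the factorization of `x` restricted to the primes `≥ N`. -/
theorem factorization_roughPart (N x : ℕ) :
    (roughPart N x).factorization = x.factorization.filter (fun p => N ≤ p) := by
  unfold roughPart
  refine Nat.prod_pow_factorization_eq_self fun p hp => ?_
  rw [Finsupp.support_filter, Finset.mem_filter, Nat.support_factorization] at hp
  exact Nat.prime_of_mem_primeFactors hp.1

/-- Pointwise form. -/
theorem factorization_roughPart_apply (N x p : ℕ) :
    (roughPart N x).factorization p = if N ≤ p then x.factorization p else 0 := by
  rw [factorization_roughPart, Finsupp.filter_apply]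

/-- The rough part is never `0`. -/
theorem roughPart_ne_zero (N x : ℕ) : roughPart N x ≠ 0 := by
  unfold roughPart
  rw [Finsupp.prod, Finset.prod_ne_zero_iff]
  intro p hp
  rw [Finsupp.support_filter, Finset.mem_filter, Nat.support_factorization] at hp
  exact pow_ne_zero _ (Nat.prime_of_mem_primeFactors hp.1).ne_zero

/-- If `N` is not prime, the keys at `N` and `N+1` coincide. -/
theorem roughPart_succ_of_not_prime {N : ℕ} (hN : ¬ N.Prime) (x : ℕ) : roughPart N x = roughPart (N + 1) x := by
  refine Nat.eq_of_factorization_eq (roughPart_ne_zero _ _) (roughPart_ne_zero _ _) fun p => ?_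
  rw [factorization_roughPart_apply, factorization_roughPart_apply]
  by_cases h : p = N
  · subst h
    simp [Nat.factorization_eq_zero_of_not_prime x hN]
  · have : N ≤ p ↔ N + 1 ≤ p := by omega
    simp [this]

/-- For a prime `p`: `roughPart p x = p^{v_p(x)} · roughPart (p+1) x`. -/
theorem roughPart_prime_eq {p : ℕ} (hp : p.Prime) (x : ℕ) :
    roughPart p x = p ^ x.factorization p * roughPart (p + 1) x := by
  refine Nat.eq_of_factorization_eq (roughPart_ne_zero _ _)
    (Nat.mul_ne_zero (pow_ne_zero _ hp.ne_zero) (roughPart_ne_zero _ _)) fun q => ?_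
  rw [Nat.factorization_mul (pow_ne_zero _ hp.ne_zero) (roughPart_ne_zero _ _), Finsupp.add_apply,
    factorization_roughPart_apply, factorization_roughPart_apply, hp.factorization_pow, Finsupp.single_apply]
  by_cases h : p = q
  · subst h; simp
  · have h1 : p ≤ q ↔ p + 1 ≤ q := by omega
    simp [h, h1]

/-- `roughPart 2 x = x` for `x ≠ 0`. -/
theorem roughPart_two {x : ℕ} (hx : x ≠ 0) : roughPart 2 x = x := by
  refine Nat.eq_of_factorization_eq (roughPart_ne_zero _ _) hx fun p => ?_
  rw [factorization_roughPart_apply]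
  by_cases h : 2 ≤ p
  · simp [h]
  · simp only [h, if_false]
    have : ¬ p.Prime := fun hp => h hp.two_le
    exact (Nat.factorization_eq_zero_of_not_prime x this).symm

/-- `roughPart N x = 1` as soon as `N` exceeds `x`: no prime `≥ N` divides `x`. -/
theorem roughPart_eq_one_of_le {N x : ℕ} (hxN : x < N) : roughPart N x = 1 := by
  refine Nat.eq_of_factorization_eq (roughPart_ne_zero _ _) one_ne_zero fun p => ?_
  rw [factorization_roughPart_apply, Nat.factorization_one, Finsupp.zero_apply]
  by_cases h : N ≤ p
  · simp only [h, if_true]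
    exact Nat.factorization_eq_zero_of_lt (by omega)
  · simp [h]

/-- Iterated keys: `roughPart N' (roughPart N x) = roughPart N' x` for `N ≤ N'`. -/
theorem roughPart_roughPart {N N' : ℕ} (h : N ≤ N') (x : ℕ) : roughPart N' (roughPart N x) = roughPart N' x := by
  refine Nat.eq_of_factorization_eq (roughPart_ne_zero _ _) (roughPart_ne_zero _ _) fun p => ?_
  rw [factorization_roughPart_apply, factorization_roughPart_apply, factorization_roughPart_apply]
  by_cases h' : N' ≤ p
  · have : N ≤ p := h.trans h'
    simp [h', this]
  · simp [h']

/-- Dividing by a power of `p` does not change the key beyond `p`. -/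
theorem roughPart_succ_div_pow {p x d : ℕ} (hp : p.Prime) (hd : p ^ d ∣ x) :
    roughPart (p + 1) (x / p ^ d) = roughPart (p + 1) x := by
  refine Nat.eq_of_factorization_eq (roughPart_ne_zero _ _) (roughPart_ne_zero _ _) fun q => ?_
  rw [factorization_roughPart_apply, factorization_roughPart_apply, Nat.factorization_div hd, Finsupp.tsub_apply,
    hp.factorization_pow, Finsupp.single_apply]
  by_cases h : p + 1 ≤ q
  · have hpq : p ≠ q := by omega
    simp [h, hpq]
  · simp [h]

/-- Multiplying by a power of `p` does not change the key beyond `p`. -/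
theorem roughPart_succ_mul_pow {p x : ℕ} (hp : p.Prime) (d : ℕ) :
    roughPart (p + 1) (x * p ^ d) = roughPart (p + 1) x := by
  have h := roughPart_succ_div_pow (x := x * p ^ d) (d := d) hp (dvd_mul_left _ _)
  rw [Nat.mul_div_cancel x (pow_pos hp.pos d)] at h
  exact h.symm

/-- `p` does not divide the key beyond `p`. -/
theorem not_dvd_roughPart_succ {p : ℕ} (hp : p.Prime) (x : ℕ) : ¬ p ∣ roughPart (p + 1) x := by
  intro h
  have hpos := hp.factorization_pos_of_dvd (roughPart_ne_zero _ _) h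
  rw [factorization_roughPart_apply] at hpos
  simp at hpos

/-- The key at `p` determines and is determined by (the key beyond `p`, the `p`-adic valuation). -/
theorem roughPart_prime_eq_iff {p : ℕ} (hp : p.Prime) (x y : ℕ) :
    roughPart p x = roughPart p y ↔
      roughPart (p + 1) x = roughPart (p + 1) y ∧ x.factorization p = y.factorization p := by
  constructor
  · intro h
    have hf : ∀ q, (roughPart p x).factorization q = (roughPart p y).factorization q := fun q => by rw [h]
    refine ⟨Nat.eq_of_factorization_eq (roughPart_ne_zero _ _) (roughPart_ne_zero _ _) fun q => ?_, ?_⟩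
    · have hq := hf q
      rw [factorization_roughPart_apply, factorization_roughPart_apply] at hq ⊢
      by_cases h1 : p + 1 ≤ q
      · have h2 : p ≤ q := by omega
        simp only [h1, if_true]; simpa [h2] using hq
      · simp [h1]
    · have hq := hf p
      simpa [factorization_roughPart_apply] using hq
  · rintro ⟨h1, h2⟩
    rw [roughPart_prime_eq hp x, roughPart_prime_eq hp y, h1, h2]

/-- The rough part divides `x` (`x ≠ 0`), hence is `≤ x`. -/
theorem roughPart_dvd {N x : ℕ} (hx : x ≠ 0) : roughPart N x ∣ x := by
  rw [← Nat.factorization_le_iff_dvd (roughPart_ne_zero _ _) hx, factorization_roughPart]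
  intro p
  rw [Finsupp.filter_apply]
  split_ifs <;> simp

end Summit.RiemannHypothesis.RiemannHypothesis.Theorems.IntegerScrew

end
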